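import Literature.NumberTheory.Automorphic.HyperspecialUnitarySatakeIsomorphismRankOne
import Literature.NumberTheory.Automorphic.UnramifiedTraceZeroLatticeIndex
import Literature.NumberTheory.Automorphic.SymplecticBorelUnipotentRadical
import HarnessLib

/-!
# The modulus index of the unramified unitary groups of relative rank one EVALUATED:
# `[K_P : K_P ∩ t_λK_Pt_λ⁻¹] = q^{λ₀⁺}` for `U(2)` and `= q^{(2λ₀)⁺}` for `U(3)` (`K_P = N(𝒪)`, Rogawski's coordinates
# `u(x, z)` on `N`; Cartier §IV (4.2), Laumon (4.1.4))

Topic `NumberTheory/Automorphic`; namespace `Literature.NumberTheory.Automorphic.HermitianLattice[.UnramifiedLocalConjDatum]`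
(lane `lit-hodgefound`, Track 2 foundations; seat `lit-hodgefound-p11`, generation 46, row g46-#2).  THEOREMS ONLY: no definition,
no named fact, no instance, no notation.  Sequel of `HyperspecialUnitarySatakeIsomorphismRankOne` (g44-#9: the Satake isomorphism
of `U(2)`, `U(3)` with the modulus LEFT AS AN INDEX `E(λ) = [K_P : t_λK_Pt_λ⁻¹]`) and of `UnramifiedTraceZeroLatticeIndex` (g46-#1:
`[L_a : L_b] = (√q)^{(a-b)⁺}` for the trace-zero balls `L_c = {v ≤ exp c} ∩ ker(id + σ)`, `√q·√q = q`).  Here the index is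
computed.

## The mathematics

`K` a field with `Valued K ℤᵐ⁰`, `hd : UnramifiedLocalConjDatum σ ϖ`, `G = U(σ, J₀) = unitaryGroupOfForm σ (J₀.over K)` with
`J₀ = antidiag(1, …, 1)`, `K₀ = unitaryInt` (hyperspecial), `P = {u · diag(ϖ^a)}` (`hd.borelLatticeU`), `K_P = P ∩ K₀`.

* (§1, any `N`) For `g ∈ U(σ, J₀)` the inverse is `g⁻¹ = J₀ σ(g)ᵀ J₀`, i.e. `(g⁻¹)_{ij} = σ(g_{rev j, rev i})`
  (`coe_inv_apply_unitary`), so `g ∈ K₀` iff all ENTRIES of `g` are integral (`mem_unitaryInt_iff_forall_v_le_one`); and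
  **`K_P = N(𝒪)`**: `x ∈ K_P` iff `x` is upper unitriangular and integral (`mem_borelLatticeU_inf_unitaryInt_iff`; the lattice
  torus `diag(ϖ^a)` meets `K₀` trivially).  The unitarity of `g` for the antidiagonal form reads entrywise
  `∑_i σ(g_{ia}) g_{rev i, b} = δ_{b, rev a}` (`sum_map_mul_rev_apply_eq`).
* (§2, `N = 2`, Rogawski §1.10: `N = {n(t)}`) an upper unitriangular `g ∈ U(2)` is `(1 β; 0 1)` with `β + σβ = 0`
  (`β ∈ K⁰`); `K_P = {v β ≤ 1}`, `t_μK_Pt_μ⁻¹ = {v β ≤ exp(-2μ₀)}` (`t_μ = diag(ϖ^{μ₀}, ϖ^{-μ₀})`), and the `(0,1)`-coordinate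
  is a homomorphism `K_P → K⁰` onto `L_0 = 𝒪 ∩ K⁰`; hence
  **`[K_P : K_P ∩ t_μK_Pt_μ⁻¹] = [L_0 : L_{-2μ₀}] = (√q)^{(2μ₀)⁺} = q^{μ₀⁺}`** (`relIndex_conjAct_borelInt_eq_pow_two`), dually
  `[t_μK_Pt_μ⁻¹ : K_P ∩ t_μK_Pt_μ⁻¹] = q^{(-μ₀)⁺}`.
* (§3, `N = 3`, Rogawski §1.10: `N = {u(x, z)}`) an upper unitriangular `g ∈ U(3)` is `u(α, β) = (1 α β; 0 1 -σα; 0 0 1)` with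
  `β + σβ + ασα = 0` (`apply_one_two_eq_three`, `apply_add_map_apply_eq_three`; for every such pair `u(α, β) ∈ U(3)` exists,
  `exists_unitriangular_apply_eq_three`); `K_P = {v α ≤ 1, v β ≤ 1}` and `t_μK_Pt_μ⁻¹ = {v α ≤ exp(-μ₀), v β ≤ exp(-2μ₀)}`
  (`t_μ = diag(ϖ^{μ₀}, 1, ϖ^{-μ₀})`).  For `μ₀ ≥ 0` the index is computed in two steps inside `K_P`: the `α`-coordinate
  `ψ : K_P → K` is a homomorphism ONTO `𝒪` (the element `u(α, -ασα·t)`, `t + σt = 1`, is integral with `α`), so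
  `[K_P : {v α ≤ exp(-μ₀)}] = [𝒪 : ϖ^{μ₀}𝒪] = q^{μ₀}`; and `{v α ≤ exp(-μ₀)} = ker ψ · t_μK_Pt_μ⁻¹` with `ker ψ = Z(𝒪) = {u(0, β)}`
  the integral CENTRE, on which `β` is a homomorphism onto `L_0`, so
  `[{v α ≤ exp(-μ₀)} : t_μK_Pt_μ⁻¹] = [Z(𝒪) : Z(𝒪) ∩ t_μK_Pt_μ⁻¹] = [L_0 : L_{-2μ₀}] = q^{μ₀}` (g46-#1).  Hence
  **`[K_P : K_P ∩ t_μK_Pt_μ⁻¹] = q^{(2μ₀)⁺}`** (`relIndex_conjAct_borelInt_eq_pow_three`), dually `q^{(-2μ₀)⁺}` — the modulus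
  `δ_B(t_μ) = |ϖ^{μ₀}|_E · |ϖ^{2μ₀}|_F = q^{-2μ₀}` (`q = q_E = q_F²`) of the Borel of `U(3)` read as an index (Cartier §IV (4.2);
  Laumon (4.1.4): `δ_B = ∏_{α>0} |α|^{dim 𝔤_α}`).
* (§4) With g44-#9: **`range 𝒮_1 = {f : f = 0 off Λ⁻, f_λ = q^{λ₀} f_{-λ} (U(2)), f_λ = q^{2λ₀} f_{-λ} (U(3)), λ₀ ≥ 0}`**
  for the COUNTING transform over every commutative ring (`range_satakeTransform_one_unitary_two/three_eq_pow`).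

## What is formalised (theorems only)

* §1 `antidiagonal_mul_apply`, `mul_antidiagonal_apply`, `map_transpose_mul_antidiagonal_mul_apply`, `sum_map_mul_rev_apply_eq`,
  `mem_unitaryGroupOfForm_antidiagonal_iff_sum`, **`coe_inv_apply_unitary`**, **`mem_unitaryInt_iff_forall_v_le_one`**,
  **`mem_borelLatticeU_inf_unitaryInt_iff`**, `coe_conj_mem_upperUnitriangular_iff` (the count `v(ϖ^m x) ≤ 1 ↔ v x ≤ exp m` is the tree's
  `SymplecticCartan.v_uniformizer_zpow_mul_le_one_iff`).
* §2 `apply_add_map_apply_eq_two`, `mem_borelInt_iff_two`, `mem_conjAct_borelInt_iff_two`, `exists_unitriangular_apply_eq_two`,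
  **`relIndex_conjAct_borelInt_eq_pow_two`**, **`relIndex_borelInt_conjAct_eq_pow_two`**.
* §3 `apply_one_two_eq_three`, `apply_add_map_apply_eq_three`, `mem_borelInt_iff_three`, `mem_conjAct_borelInt_iff_three`,
  `exists_unitriangular_apply_eq_three`, **`relIndex_conjAct_borelInt_eq_pow_three`**, **`relIndex_borelInt_conjAct_eq_pow_three`**.
* §4 **`range_satakeTransform_one_unitary_two_eq_pow`**, **`range_satakeTransform_one_unitary_three_eq_pow`**.

## References
* [Rogawski1990] J. D. Rogawski, *Automorphic Representations of Unitary Groups in Three Variables*, Ann. of Math. Stud. 123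
  (1990), §1.10 p. 14 (`N = {u(x, z) : x x̄ = z + z̄}`, `n(w) = u(0, w)`, `w ∈ E⁰`; `U(2)`: `N = {n(t)}`), §4.5 p. 50.
* [CartierCorvallis1979] P. Cartier, *Representations of 𝔭-adic groups: a survey*, PSPM 33.1 (1979), §I.3, §IV (4.2), Thm. 4.1.
* [Laumon1995] G. Laumon, *Cohomology of Drinfeld Modular Varieties I*, CUP (1996), (4.1.3)–(4.1.6).
* [BruhatTits1972] F. Bruhat, J. Tits, *Groupes réductifs sur un corps local I*, Publ. Math. IHÉS 41 (1972), (4.4.3), (4.4.4).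
* [Minguez2011] A. Mínguez, *Unramified representations of unitary groups*, in: *On the stabilization of the trace formula*
  (2011), §4.
* [Serre1979] J.-P. Serre, *Local Fields*, GTM 67 (1979), Ch. V §2.
-/

noncomputable section

open scoped Valued WithZero Matrix MatrixGroups Pointwise
open MonoidAlgebra Representation Finset MulAction ConjAct

namespace Literature.NumberTheory.Automorphic.HermitianLattice

open Literature.NumberTheory.Automorphic.CartanUnique Literature.NumberTheory.Automorphic.SymplecticCartan
  Literature.NumberTheory.Automorphic

variable {K : Type*} [Field K] [Valued K ℤᵐ⁰] {σ : K →+* K} {ϖ : K} {N : ℕ}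

/-! ## §1 Any `N`: the antidiagonal unitarity identity entrywise, inverses, `K₀` by entries, `K_P = N(𝒪)` -/

omit [Valued K ℤᵐ⁰] in
/-- Entries of `J₀ = antidiag(1, …, 1)`. [cite: Rogawski1990, §1.9–§1.10] -/
private theorem antidiagonal_over_apply_eq (i j : Fin N) :
    (StdForm.antidiagonal N).over K i j = if j = Fin.rev i then (1 : K) else 0 := by
  simp only [StdForm.over, Matrix.map_apply, StdForm.antidiagonal_J_apply]
  split_ifs <;> simp

omit [Valued K ℤᵐ⁰] in
/-- `(J₀ X)_{ij} = X_{rev i, j}`. [cite: Rogawski1990, §1.9–§1.10] -/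
theorem antidiagonal_mul_apply (X : Matrix (Fin N) (Fin N) K) (i j : Fin N) :
    ((StdForm.antidiagonal N).over K * X) i j = X (Fin.rev i) j := by
  rw [Matrix.mul_apply, Finset.sum_eq_single (Fin.rev i)]
  · rw [antidiagonal_over_apply_eq, if_pos rfl, one_mul]
  · intro l _ hl; rw [antidiagonal_over_apply_eq, if_neg hl, zero_mul]
  · intro h; exact absurd (Finset.mem_univ _) h

omit [Valued K ℤᵐ⁰] in
/-- `(X J₀)_{ij} = X_{i, rev j}`. [cite: Rogawski1990, §1.9–§1.10] -/
theorem mul_antidiagonal_apply (X : Matrix (Fin N) (Fin N) K) (i j : Fin N) :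
    (X * (StdForm.antidiagonal N).over K) i j = X i (Fin.rev j) := by
  rw [Matrix.mul_apply, Finset.sum_eq_single (Fin.rev j)]
  · rw [antidiagonal_over_apply_eq, if_pos (Fin.rev_rev j).symm, mul_one]
  · intro l _ hl
    rw [antidiagonal_over_apply_eq, if_neg (fun h => hl (by rw [h, Fin.rev_rev])), mul_zero]
  · intro h; exact absurd (Finset.mem_univ _) h

omit [Valued K ℤᵐ⁰] in
/-- **The antidiagonal unitarity form entrywise**: `(σ(A)ᵀ J₀ A)_{ab} = ∑_i σ(A_{ia}) A_{rev i, b}`.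
[cite: Rogawski1990, §1.9–§1.10] -/
theorem map_transpose_mul_antidiagonal_mul_apply (A : Matrix (Fin N) (Fin N) K) (a b : Fin N) :
    ((A.map σ)ᵀ * (StdForm.antidiagonal N).over K * A) a b = ∑ i, σ (A i a) * A (Fin.rev i) b := by
  rw [Matrix.mul_assoc, Matrix.mul_apply]
  refine Finset.sum_congr rfl fun i _ => ?_
  rw [Matrix.transpose_apply, Matrix.map_apply, antidiagonal_mul_apply]

omit [Valued K ℤᵐ⁰] in
/-- **Membership in `U(σ, J₀)` entrywise**: `g ∈ U(σ, J₀)` iff `∑_i σ(g_{ia}) g_{rev i, b} = δ_{b, rev a}` for all `a, b`.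
[cite: Rogawski1990, §1.9–§1.10] -/
theorem mem_unitaryGroupOfForm_antidiagonal_iff_sum (g : GL (Fin N) K) :
    g ∈ unitaryGroupOfForm σ ((StdForm.antidiagonal N).over K) ↔
      ∀ a b : Fin N, ∑ i, σ ((g : Matrix (Fin N) (Fin N) K) i a) * (g : Matrix (Fin N) (Fin N) K) (Fin.rev i) b =
        if b = Fin.rev a then 1 else 0 := by
  rw [mem_unitaryGroupOfForm_iff]
  constructor
  · intro h a b
    rw [← map_transpose_mul_antidiagonal_mul_apply, h, antidiagonal_over_apply_eq]
  · intro h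
    ext a b
    rw [map_transpose_mul_antidiagonal_mul_apply, h, antidiagonal_over_apply_eq]

omit [Valued K ℤᵐ⁰] in
/-- For `g ∈ U(σ, J₀)`: `∑_i σ(g_{ia}) g_{rev i, b} = δ_{b, rev a}`. [cite: Rogawski1990, §1.9–§1.10] -/
theorem sum_map_mul_rev_apply_eq (g : unitaryGroupOfForm σ ((StdForm.antidiagonal N).over K)) (a b : Fin N) :
    ∑ i, σ (((g : GL (Fin N) K) : Matrix (Fin N) (Fin N) K) i a) * ((g : GL (Fin N) K) : Matrix (Fin N) (Fin N) K) (Fin.rev i) b =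
      if b = Fin.rev a then 1 else 0 :=
  (mem_unitaryGroupOfForm_antidiagonal_iff_sum _).1 g.2 a b

omit [Valued K ℤᵐ⁰] in
/-- **`g⁻¹ = J₀ σ(g)ᵀ J₀` for `g ∈ U(σ, J₀)`**: `(g⁻¹)_{ij} = σ(g_{rev j, rev i})`. [cite: Rogawski1990, §1.9 p. 13
(`α(g) g = 1`, `α(g) = Φ ᵗḡ Φ⁻¹`)] -/
theorem coe_inv_apply_unitary (g : unitaryGroupOfForm σ ((StdForm.antidiagonal N).over K)) (i j : Fin N) :
    (((g⁻¹ : unitaryGroupOfForm σ ((StdForm.antidiagonal N).over K)) : GL (Fin N) K) : Matrix (Fin N) (Fin N) K) i j =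
      σ (((g : GL (Fin N) K) : Matrix (Fin N) (Fin N) K) (Fin.rev j) (Fin.rev i)) := by
  set A : Matrix (Fin N) (Fin N) K := ((g : GL (Fin N) K) : Matrix (Fin N) (Fin N) K) with hA
  have hg : (A.map σ)ᵀ * (StdForm.antidiagonal N).over K * A = (StdForm.antidiagonal N).over K := g.2
  have hleft : (StdForm.antidiagonal N).over K * (A.map σ)ᵀ * (StdForm.antidiagonal N).over K * A = 1 := by
    rw [Matrix.mul_assoc, Matrix.mul_assoc, ← Matrix.mul_assoc (A.map σ)ᵀ, hg, StdForm.over_mul_over]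
  have hinv : A⁻¹ = (StdForm.antidiagonal N).over K * (A.map σ)ᵀ * (StdForm.antidiagonal N).over K :=
    Matrix.inv_eq_left_inv hleft
  rw [Subgroup.coe_inv, Matrix.coe_units_inv, hinv, mul_antidiagonal_apply, antidiagonal_mul_apply, Matrix.transpose_apply,
    Matrix.map_apply]

/-- **`K₀` by entries**: for `U(σ, J₀)` with `v ∘ σ = v`, `g ∈ K₀ = U(σ, J₀) ∩ GL_N(𝒪)` iff all entries of `g` are integral
(those of `g⁻¹` are then `σ` of entries of `g`). [cite: Tits1979, §3.3.3] [cite: Rogawski1990, §1.10 p. 14 (`K_v` = integer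
matrices in `G_v`)] -/
theorem mem_unitaryInt_iff_forall_v_le_one (hvσ : ∀ x, Valued.v (σ x) = Valued.v x)
    {g : unitaryGroupOfForm σ ((StdForm.antidiagonal N).over K)} :
    g ∈ unitaryInt σ ((StdForm.antidiagonal N).over K) ↔
      ∀ i j, Valued.v (((g : GL (Fin N) K) : Matrix (Fin N) (Fin N) K) i j) ≤ 1 := by
  rw [mem_unitaryInt_iff]
  refine ⟨fun h => h.1, fun h => ⟨h, fun i j => ?_⟩⟩
  rw [← Subgroup.coe_inv, coe_inv_apply_unitary, hvσ]
  exact h _ _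

namespace UnramifiedLocalConjDatum

/-- **`K_P = N(𝒪)`**: `x ∈ K_P = P ∩ K₀` iff `x` is upper unitriangular and lies in `K₀` (an element `u · diag(ϖ^a)` of `P`
in `K₀` has `a = a(x) = 0`). [cite: CartierCorvallis1979, §IV (4.2)] [cite: BruhatTits1972, (4.4.3)] -/
theorem mem_borelLatticeU_inf_unitaryInt_iff (hd : UnramifiedLocalConjDatum σ ϖ)
    {x : unitaryGroupOfForm σ ((StdForm.antidiagonal N).over K)} :
    x ∈ hd.borelLatticeU ⊓ unitaryInt σ ((StdForm.antidiagonal N).over K) ↔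
      (x : GL (Fin N) K) ∈ upperUnitriangular (Fin N) K ∧ x ∈ unitaryInt σ ((StdForm.antidiagonal N).over K) := by
  constructor
  · intro hx
    obtain ⟨hxP, hxK⟩ := Subgroup.mem_inf.1 hx
    exact ⟨hd.coe_mem_upperUnitriangular_of_iwasawaExp_eq_zero hxP (hd.iwasawaExp_of_mem_unitaryInt hxK), hxK⟩
  · rintro ⟨hxU, hxK⟩
    refine Subgroup.mem_inf.2 ⟨?_, hxK⟩
    have h := hd.unipotent_mul_torus_mem_borelLatticeU (u := x) (t := 1) hxU (a := 0)
      (fun _ => by rw [Pi.zero_apply, Pi.zero_apply, neg_zero]) (by rw [OneMemClass.coe_one, zpowDiagGL_zero])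
    rwa [mul_one] at h

end UnramifiedLocalConjDatum

omit [Valued K ℤᵐ⁰] in
/-- `diag(ϖ^μ)⁻¹ g diag(ϖ^μ)` is upper unitriangular iff `g` is. [cite: BruhatTits1972, (4.4.4) (ii)] -/
theorem coe_conj_mem_upperUnitriangular_iff {hϖ0 : ϖ ≠ 0} (μ : Fin N → ℤ) (g : GL (Fin N) K) :
    (zpowDiagGL hϖ0 μ)⁻¹ * g * zpowDiagGL hϖ0 μ ∈ upperUnitriangular (Fin N) K ↔ g ∈ upperUnitriangular (Fin N) K := by
  constructor
  · intro h
    have h' := zpowDiagGL_mul_mul_inv_mem_upperUnitriangular hϖ0 μ h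
    rwa [← mul_assoc, ← mul_assoc, mul_inv_cancel, one_mul, mul_assoc, mul_inv_cancel, mul_one] at h'
  · intro h
    have h' := zpowDiagGL_mul_mul_inv_mem_upperUnitriangular hϖ0 (-μ) h
    rwa [zpowDiagGL_neg, inv_inv] at h'

omit [Valued K ℤᵐ⁰] in
/-- An index identity in a lattice of subgroups: `[Y ∩ Z : X ∩ Y ∩ Z]` computed with or without `Z` on the left. [folklore] -/
private theorem relIndex_inf_right_eq (X Y Z : AddSubgroup K) : X.relIndex (Y ⊓ Z) = (X ⊓ Z).relIndex (Y ⊓ Z) := by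
  rw [← AddSubgroup.inf_relIndex_right X, ← AddSubgroup.inf_relIndex_right (X ⊓ Z), inf_assoc,
    inf_eq_right.2 (inf_le_right : Y ⊓ Z ≤ Z)]

/-! ## §2 `N = 2`: `N(K) = {(1 β; 0 1) : β + σβ = 0}` and `[K_P : K_P ∩ t_μK_Pt_μ⁻¹] = q^{μ₀⁺}` -/

omit [Valued K ℤᵐ⁰] in
/-- **An upper unitriangular `g ∈ U(2)` has `g₀₁ + σ(g₀₁) = 0`** (the `(1,1)` entry of `σ(g)ᵀJ₀g = J₀`): Rogawski's `N = {n(t)}`,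
`t` in the trace-zero line. [cite: Rogawski1990, §1.10 p. 14] -/
theorem apply_add_map_apply_eq_two {g : unitaryGroupOfForm σ ((StdForm.antidiagonal 2).over K)}
    (hg : (g : GL (Fin 2) K) ∈ upperUnitriangular (Fin 2) K) :
    ((g : GL (Fin 2) K) : Matrix (Fin 2) (Fin 2) K) 0 1 + σ (((g : GL (Fin 2) K) : Matrix (Fin 2) (Fin 2) K) 0 1) = 0 := by
  have h := sum_map_mul_rev_apply_eq g 1 1
  rw [Fin.sum_univ_two, show Fin.rev (0 : Fin 2) = 1 from by decide, show Fin.rev (1 : Fin 2) = 0 from by decide,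
    if_neg (by decide), apply_self_of_mem_upperUnitriangular hg, map_one, one_mul, mul_one] at h
  rw [add_comm]
  exact h

namespace UnramifiedLocalConjDatum

/-- **`K_P` of `U(2)` by the coordinate `β = g₀₁`**: `g ∈ K_P` iff `g` is upper unitriangular with `v(β) ≤ 1`.
[cite: Rogawski1990, §1.10 p. 14] [cite: CartierCorvallis1979, §IV (4.2)] -/
theorem mem_borelInt_iff_two (hd : UnramifiedLocalConjDatum σ ϖ) {g : unitaryGroupOfForm σ ((StdForm.antidiagonal 2).over K)} :
    g ∈ hd.borelLatticeU ⊓ unitaryInt σ ((StdForm.antidiagonal 2).over K) ↔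
      (g : GL (Fin 2) K) ∈ upperUnitriangular (Fin 2) K ∧ Valued.v (((g : GL (Fin 2) K) : Matrix (Fin 2) (Fin 2) K) 0 1) ≤ 1 := by
  rw [hd.mem_borelLatticeU_inf_unitaryInt_iff, mem_unitaryInt_iff_forall_v_le_one hd.vσ]
  refine and_congr_right fun hU => ⟨fun h => h 0 1, fun h i j => ?_⟩
  have hT := blockTriangular_of_mem_upperUnitriangular hU
  fin_cases i <;> fin_cases j
  · rw [apply_self_of_mem_upperUnitriangular hU, map_one]
  · exact h
  · rw [hT (by decide), map_zero]; exact zero_le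
  · rw [apply_self_of_mem_upperUnitriangular hU, map_one]

/-- **`t_μK_Pt_μ⁻¹` of `U(2)`** (`t_μ = diag(ϖ^{μ₀}, ϖ^{-μ₀})`): `g ∈ t_μK_Pt_μ⁻¹` iff `g` is upper unitriangular with
`v(β) ≤ exp(-2μ₀)` (conjugation by `t_μ⁻¹` multiplies `β` by `ϖ^{-2μ₀}`). [cite: CartierCorvallis1979, §IV (4.2)]
[cite: BruhatTits1972, (4.4.4) (ii)] -/
theorem mem_conjAct_borelInt_iff_two (hd : UnramifiedLocalConjDatum σ ϖ) {μ : Fin 2 → ℤ} (hμ : ∀ i, μ (Fin.rev i) = -μ i)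
    {g : unitaryGroupOfForm σ ((StdForm.antidiagonal 2).over K)} :
    g ∈ toConjAct (⟨zpowDiagGL (uniformizer_ne_zero hd.vϖ) μ, zpowDiagGL_mem_unitaryGroupOfForm hd.σϖ _ hμ⟩ :
          unitaryGroupOfForm σ ((StdForm.antidiagonal 2).over K)) •
        (hd.borelLatticeU ⊓ unitaryInt σ ((StdForm.antidiagonal 2).over K)) ↔
      (g : GL (Fin 2) K) ∈ upperUnitriangular (Fin 2) K ∧
        Valued.v (((g : GL (Fin 2) K) : Matrix (Fin 2) (Fin 2) K) 0 1) ≤ WithZero.exp (-(2 * μ 0)) := by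
  have hϖ0 := uniformizer_ne_zero hd.vϖ
  have hμ1 : μ 1 = -μ 0 := by have := hμ 0; rwa [show Fin.rev (0 : Fin 2) = 1 from by decide] at this
  rw [Subgroup.mem_pointwise_smul_iff_inv_smul_mem, ← toConjAct_inv, toConjAct_smul, inv_inv, hd.mem_borelInt_iff_two]
  have hcoe : (((⟨zpowDiagGL hϖ0 μ, zpowDiagGL_mem_unitaryGroupOfForm hd.σϖ _ hμ⟩ :
        unitaryGroupOfForm σ ((StdForm.antidiagonal 2).over K))⁻¹ * g *
      (⟨zpowDiagGL hϖ0 μ, zpowDiagGL_mem_unitaryGroupOfForm hd.σϖ _ hμ⟩ :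
        unitaryGroupOfForm σ ((StdForm.antidiagonal 2).over K)) : unitaryGroupOfForm σ ((StdForm.antidiagonal 2).over K)) :
        GL (Fin 2) K) = (zpowDiagGL hϖ0 μ)⁻¹ * (g : GL (Fin 2) K) * zpowDiagGL hϖ0 μ := by
    rw [Subgroup.coe_mul, Subgroup.coe_mul, Subgroup.coe_inv]
  rw [hcoe, coe_conj_mem_upperUnitriangular_iff, coe_zpowDiagGL_inv_mul_mul_zpowDiagGL_apply, hμ1,
    v_uniformizer_zpow_mul_le_one_iff hd.vϖ, show -μ 0 - μ 0 = -(2 * μ 0) by ring]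

/-- **Every `β ∈ K⁰` is the coordinate of an element of `N(K) ≤ U(2)`**: for `β + σβ = 0` the matrix `(1 β; 0 1)` lies in
`U(σ, J₀)`. [cite: Rogawski1990, §1.10 p. 14] -/
theorem exists_unitriangular_apply_eq_two (hd : UnramifiedLocalConjDatum σ ϖ) {β : K} (hβ : β + σ β = 0) :
    ∃ g : unitaryGroupOfForm σ ((StdForm.antidiagonal 2).over K),
      (g : GL (Fin 2) K) ∈ upperUnitriangular (Fin 2) K ∧ ((g : GL (Fin 2) K) : Matrix (Fin 2) (Fin 2) K) 0 1 = β := by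
  have _ := hd.σσ
  have hdet : (!![(1 : K), β; 0, 1] : Matrix (Fin 2) (Fin 2) K).det ≠ 0 := by
    rw [Matrix.det_fin_two_of]; simp
  have hmem : Matrix.GeneralLinearGroup.mkOfDetNeZero _ hdet ∈ unitaryGroupOfForm σ ((StdForm.antidiagonal 2).over K) := by
    rw [mem_unitaryGroupOfForm_antidiagonal_iff_sum]
    intro a b
    have r0 : Fin.rev (0 : Fin 2) = 1 := by decide
    have r1 : Fin.rev (1 : Fin 2) = 0 := by decide
    have hσβ : σ β = -β := eq_neg_of_add_eq_zero_right hβ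
    fin_cases a <;> fin_cases b <;>
      simp [Matrix.GeneralLinearGroup.mkOfDetNeZero, Fin.sum_univ_two, r0, r1, hσβ]
  refine ⟨⟨_, hmem⟩, ?_, rfl⟩
  rw [mem_upperUnitriangular_iff]
  refine ⟨fun i j hij => ?_, fun i => ?_⟩
  · fin_cases i <;> fin_cases j
    · exact absurd hij (by decide)
    · exact absurd hij (by decide)
    · rfl
    · exact absurd hij (by decide)
  · fin_cases i <;> rfl

/-- **THE MODULUS OF THE BOREL OF `U(2)` AS AN INDEX**: for `μ` antisymmetric (`μ = (μ₀, -μ₀)`, `t_μ = diag(ϖ^{μ₀}, ϖ^{-μ₀})`),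
`[K_P : K_P ∩ t_μK_Pt_μ⁻¹] = q^{μ₀⁺}` (`q = #𝓀[K]`; `σ ≠ id`): along the coordinate `β : K_P → K⁰` the index is
`[L_0 : L_{-2μ₀}] = (√q)^{(2μ₀)⁺}` (g46-#1).  This is `δ_B(t_μ)^{-1} = |ϖ^{2μ₀}|_F^{-1} = q_F^{2μ₀}` for `μ₀ ≥ 0`.
[cite: CartierCorvallis1979, §I.3, §IV (4.2)] [cite: Laumon1995, (4.1.4)] [cite: Rogawski1990, §1.10 p. 14] -/
theorem relIndex_conjAct_borelInt_eq_pow_two (hd : UnramifiedLocalConjDatum σ ϖ) (hσ : ∃ x : K, σ x ≠ x) [Finite 𝓀[K]]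
    {μ : Fin 2 → ℤ} (hμ : ∀ i, μ (Fin.rev i) = -μ i) :
    (toConjAct (⟨zpowDiagGL (uniformizer_ne_zero hd.vϖ) μ, zpowDiagGL_mem_unitaryGroupOfForm hd.σϖ _ hμ⟩ :
          unitaryGroupOfForm σ ((StdForm.antidiagonal 2).over K)) •
        (hd.borelLatticeU ⊓ unitaryInt σ ((StdForm.antidiagonal 2).over K))).relIndex
        (hd.borelLatticeU ⊓ unitaryInt σ ((StdForm.antidiagonal 2).over K)) = Nat.card 𝓀[K] ^ (μ 0).toNat := by
  set KP := hd.borelLatticeU ⊓ unitaryInt σ ((StdForm.antidiagonal 2).over K) with hKP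
  set A := toConjAct (⟨zpowDiagGL (uniformizer_ne_zero hd.vϖ) μ, zpowDiagGL_mem_unitaryGroupOfForm hd.σϖ _ hμ⟩ :
      unitaryGroupOfForm σ ((StdForm.antidiagonal 2).over K)) • KP with hA
  -- the coordinate `β : K_P → K`
  have hKU : ∀ g : KP, ((g : unitaryGroupOfForm σ ((StdForm.antidiagonal 2).over K)) : GL (Fin 2) K) ∈ upperUnitriangular (Fin 2) K :=
    fun g => (hd.mem_borelInt_iff_two.1 g.2).1
  let ψ : KP →* Multiplicative K :=
    { toFun := fun g => Multiplicative.ofAdd ((((g : unitaryGroupOfForm σ ((StdForm.antidiagonal 2).over K)) : GL (Fin 2) K) :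
        Matrix (Fin 2) (Fin 2) K) 0 1)
      map_one' := by
        rw [OneMemClass.coe_one, OneMemClass.coe_one, Units.val_one, Matrix.one_apply_ne (by decide), ofAdd_zero]
      map_mul' := fun g h => by
        rw [← ofAdd_add, Subgroup.coe_mul, Subgroup.coe_mul, Units.val_mul, Matrix.mul_apply, Fin.sum_univ_two,
          apply_self_of_mem_upperUnitriangular (hKU g), apply_self_of_mem_upperUnitriangular (hKU h), one_mul, mul_one,
          add_comm] }
  have hψ : ∀ g : KP, Multiplicative.toAdd (ψ g) =
      (((g : unitaryGroupOfForm σ ((StdForm.antidiagonal 2).over K)) : GL (Fin 2) K) : Matrix (Fin 2) (Fin 2) K) 0 1 := fun _ => rfl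
  -- `A ∩ K_P`, seen in `K_P`, is the preimage of the ball of radius `exp(-2μ₀)`
  have hcomap : A.subgroupOf KP = (AddSubgroup.toSubgroup ((Valued.v : Valuation K ℤᵐ⁰).leAddSubgroup (WithZero.exp (-(2 * μ 0))))).comap ψ := by
    ext g
    rw [Subgroup.mem_subgroupOf, hA, hd.mem_conjAct_borelInt_iff_two hμ, Subgroup.mem_comap, Multiplicative.mem_toSubgroup,
      Valuation.mem_leAddSubgroup_iff, hψ]
    exact ⟨fun h => h.2, fun h => ⟨hKU g, h⟩⟩
  -- the image of `β` is `L_0 = 𝒪 ∩ K⁰`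
  have hrange : ψ.range = AddSubgroup.toSubgroup
      ((Valued.v : Valuation K ℤᵐ⁰).leAddSubgroup (WithZero.exp (0 : ℤ)) ⊓ (AddMonoidHom.id K + σ.toAddMonoidHom).ker) := by
    ext x
    rw [MonoidHom.mem_range, Multiplicative.mem_toSubgroup, AddSubgroup.mem_inf, Valuation.mem_leAddSubgroup_iff,
      WithZero.exp_zero, mem_ker_id_add_iff]
    constructor
    · rintro ⟨g, rfl⟩
      exact ⟨(hd.mem_borelInt_iff_two.1 g.2).2, apply_add_map_apply_eq_two (hKU g)⟩
    · rintro ⟨hx, hxσ⟩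
      obtain ⟨g, hgU, hgx⟩ := hd.exists_unitriangular_apply_eq_two hxσ
      have hgKP : g ∈ KP := hd.mem_borelInt_iff_two.2 ⟨hgU, by rw [hgx]; exact hx⟩
      exact ⟨⟨g, hgKP⟩, by rw [← ofAdd_toAdd (ψ _), hψ]; exact congrArg _ hgx⟩
  rw [Subgroup.relIndex, hcomap, Subgroup.index_comap, hrange, AddSubgroup.relIndex_toSubgroup, relIndex_inf_right_eq, hd.relIndex_leAddSubgroup_inf_ker_add_exp hσ, zero_sub, neg_neg,
    show (2 * μ 0).toNat = 2 * (μ 0).toNat by omega, pow_mul, sq, hd.sqrt_card_residueField_mul_self hσ]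

/-- **The dual index for `U(2)`**: `[t_μK_Pt_μ⁻¹ : K_P ∩ t_μK_Pt_μ⁻¹] = q^{(-μ₀)⁺}` (conjugate by `t_μ⁻¹ = t_{-μ}`).
[cite: CartierCorvallis1979, §I.3, §IV (4.2)] [cite: Laumon1995, (4.1.4)] -/
theorem relIndex_borelInt_conjAct_eq_pow_two (hd : UnramifiedLocalConjDatum σ ϖ) (hσ : ∃ x : K, σ x ≠ x) [Finite 𝓀[K]]
    {μ : Fin 2 → ℤ} (hμ : ∀ i, μ (Fin.rev i) = -μ i) :
    (hd.borelLatticeU ⊓ unitaryInt σ ((StdForm.antidiagonal 2).over K)).relIndex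
        (toConjAct (⟨zpowDiagGL (uniformizer_ne_zero hd.vϖ) μ, zpowDiagGL_mem_unitaryGroupOfForm hd.σϖ _ hμ⟩ :
            unitaryGroupOfForm σ ((StdForm.antidiagonal 2).over K)) •
          (hd.borelLatticeU ⊓ unitaryInt σ ((StdForm.antidiagonal 2).over K))) = Nat.card 𝓀[K] ^ (-μ 0).toNat := by
  have hneg : ∀ i, (-μ) (Fin.rev i) = -(-μ) i := fun i => by rw [Pi.neg_apply, Pi.neg_apply, hμ]
  have e : (⟨zpowDiagGL (uniformizer_ne_zero hd.vϖ) (-μ), zpowDiagGL_mem_unitaryGroupOfForm hd.σϖ _ hneg⟩ :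
        unitaryGroupOfForm σ ((StdForm.antidiagonal 2).over K)) =
      (⟨zpowDiagGL (uniformizer_ne_zero hd.vϖ) μ, zpowDiagGL_mem_unitaryGroupOfForm hd.σϖ _ hμ⟩ :
        unitaryGroupOfForm σ ((StdForm.antidiagonal 2).over K))⁻¹ :=
    Subtype.ext (zpowDiagGL_neg _ μ)
  have h := hd.relIndex_conjAct_borelInt_eq_pow_two hσ hneg
  rw [e, toConjAct_inv] at h
  have e' := Subgroup.relIndex_pointwise_smul
    (toConjAct (⟨zpowDiagGL (uniformizer_ne_zero hd.vϖ) μ, zpowDiagGL_mem_unitaryGroupOfForm hd.σϖ _ hμ⟩ :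
      unitaryGroupOfForm σ ((StdForm.antidiagonal 2).over K)))⁻¹
    (hd.borelLatticeU ⊓ unitaryInt σ ((StdForm.antidiagonal 2).over K))
    (toConjAct (⟨zpowDiagGL (uniformizer_ne_zero hd.vϖ) μ, zpowDiagGL_mem_unitaryGroupOfForm hd.σϖ _ hμ⟩ :
      unitaryGroupOfForm σ ((StdForm.antidiagonal 2).over K)) • (hd.borelLatticeU ⊓ unitaryInt σ ((StdForm.antidiagonal 2).over K)))
  rw [inv_smul_smul] at e'
  rw [← e', h, Pi.neg_apply]

end UnramifiedLocalConjDatum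

/-! ## §3 `N = 3`: `N(K) = {u(α, β) = (1 α β; 0 1 -σα; 0 0 1) : β + σβ + ασα = 0}` and `[K_P : K_P ∩ t_μK_Pt_μ⁻¹] = q^{(2μ₀)⁺}` -/

omit [Valued K ℤᵐ⁰] in
/-- **An upper unitriangular `g ∈ U(3)` has `g₁₂ = -σ(g₀₁)`** (the `(1,2)` entry of `σ(g)ᵀJ₀g = J₀`; Rogawski's `u(x, z)` has
`x̄` there for his form `Φ₃ = antidiag(1, -1, 1)`). [cite: Rogawski1990, §1.10 p. 14] -/
theorem apply_one_two_eq_three {g : unitaryGroupOfForm σ ((StdForm.antidiagonal 3).over K)}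
    (hg : (g : GL (Fin 3) K) ∈ upperUnitriangular (Fin 3) K) :
    ((g : GL (Fin 3) K) : Matrix (Fin 3) (Fin 3) K) 1 2 = -σ (((g : GL (Fin 3) K) : Matrix (Fin 3) (Fin 3) K) 0 1) := by
  have h := sum_map_mul_rev_apply_eq g 1 2
  have hT := blockTriangular_of_mem_upperUnitriangular hg
  rw [Fin.sum_univ_three, show Fin.rev (0 : Fin 3) = 2 from by decide, show Fin.rev (1 : Fin 3) = 1 from by decide,
    show Fin.rev (2 : Fin 3) = 0 from by decide, if_neg (by decide), apply_self_of_mem_upperUnitriangular hg,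
    apply_self_of_mem_upperUnitriangular hg, hT (show ((1 : Fin 3) : Fin 3) < 2 by decide), map_one, map_zero, mul_one, one_mul,
    zero_mul, add_zero] at h
  linear_combination h

omit [Valued K ℤᵐ⁰] in
/-- **The coordinates of an upper unitriangular `g = u(α, β) ∈ U(3)` satisfy `β + σβ + ασα = 0`** (the `(2,2)` entry of
`σ(g)ᵀJ₀g = J₀`; Rogawski: `x x̄ = z + z̄` for `Φ₃`). [cite: Rogawski1990, §1.10 p. 14] -/
theorem apply_add_map_apply_eq_three (hσσ : ∀ x, σ (σ x) = x) {g : unitaryGroupOfForm σ ((StdForm.antidiagonal 3).over K)}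
    (hg : (g : GL (Fin 3) K) ∈ upperUnitriangular (Fin 3) K) :
    ((g : GL (Fin 3) K) : Matrix (Fin 3) (Fin 3) K) 0 2 + σ (((g : GL (Fin 3) K) : Matrix (Fin 3) (Fin 3) K) 0 2) +
      ((g : GL (Fin 3) K) : Matrix (Fin 3) (Fin 3) K) 0 1 * σ (((g : GL (Fin 3) K) : Matrix (Fin 3) (Fin 3) K) 0 1) = 0 := by
  have h := sum_map_mul_rev_apply_eq g 2 2
  rw [Fin.sum_univ_three, show Fin.rev (0 : Fin 3) = 2 from by decide, show Fin.rev (1 : Fin 3) = 1 from by decide,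
    show Fin.rev (2 : Fin 3) = 0 from by decide, if_neg (by decide), apply_self_of_mem_upperUnitriangular hg,
    apply_one_two_eq_three hg, map_one, map_neg, hσσ, mul_one, one_mul] at h
  linear_combination h

namespace UnramifiedLocalConjDatum

/-- **`K_P` of `U(3)` by the coordinates `α = g₀₁`, `β = g₀₂`**: `g ∈ K_P` iff `g` is upper unitriangular with `v(α) ≤ 1` and
`v(β) ≤ 1` (the remaining entry `-σα` is then integral). [cite: Rogawski1990, §1.10 p. 14] [cite: CartierCorvallis1979, §IV (4.2)] -/
theorem mem_borelInt_iff_three (hd : UnramifiedLocalConjDatum σ ϖ) {g : unitaryGroupOfForm σ ((StdForm.antidiagonal 3).over K)} :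
    g ∈ hd.borelLatticeU ⊓ unitaryInt σ ((StdForm.antidiagonal 3).over K) ↔
      (g : GL (Fin 3) K) ∈ upperUnitriangular (Fin 3) K ∧ Valued.v (((g : GL (Fin 3) K) : Matrix (Fin 3) (Fin 3) K) 0 1) ≤ 1 ∧
        Valued.v (((g : GL (Fin 3) K) : Matrix (Fin 3) (Fin 3) K) 0 2) ≤ 1 := by
  rw [hd.mem_borelLatticeU_inf_unitaryInt_iff, mem_unitaryInt_iff_forall_v_le_one hd.vσ]
  refine and_congr_right fun hU => ⟨fun h => ⟨h 0 1, h 0 2⟩, fun h i j => ?_⟩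
  have hT := blockTriangular_of_mem_upperUnitriangular hU
  fin_cases i <;> fin_cases j
  · rw [apply_self_of_mem_upperUnitriangular hU, map_one]
  · exact h.1
  · exact h.2
  · rw [hT (by decide), map_zero]; exact zero_le
  · rw [apply_self_of_mem_upperUnitriangular hU, map_one]
  · show Valued.v (((g : GL (Fin 3) K) : Matrix (Fin 3) (Fin 3) K) 1 2) ≤ 1
    rw [apply_one_two_eq_three hU, Valuation.map_neg, hd.vσ]; exact h.1
  · rw [hT (by decide), map_zero]; exact zero_le
  · rw [hT (by decide), map_zero]; exact zero_le
  · rw [apply_self_of_mem_upperUnitriangular hU, map_one]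

/-- **`t_μK_Pt_μ⁻¹` of `U(3)`** (`μ = (μ₀, 0, -μ₀)`, `t_μ = diag(ϖ^{μ₀}, 1, ϖ^{-μ₀})`): `g ∈ t_μK_Pt_μ⁻¹` iff `g` is upper
unitriangular with `v(α) ≤ exp(-μ₀)` and `v(β) ≤ exp(-2μ₀)` (conjugation by `t_μ⁻¹` multiplies `α` by `ϖ^{-μ₀}` and `β` by
`ϖ^{-2μ₀}`). [cite: CartierCorvallis1979, §IV (4.2)] [cite: BruhatTits1972, (4.4.4) (ii)] -/
theorem mem_conjAct_borelInt_iff_three (hd : UnramifiedLocalConjDatum σ ϖ) {μ : Fin 3 → ℤ} (hμ : ∀ i, μ (Fin.rev i) = -μ i)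
    {g : unitaryGroupOfForm σ ((StdForm.antidiagonal 3).over K)} :
    g ∈ toConjAct (⟨zpowDiagGL (uniformizer_ne_zero hd.vϖ) μ, zpowDiagGL_mem_unitaryGroupOfForm hd.σϖ _ hμ⟩ :
          unitaryGroupOfForm σ ((StdForm.antidiagonal 3).over K)) •
        (hd.borelLatticeU ⊓ unitaryInt σ ((StdForm.antidiagonal 3).over K)) ↔
      (g : GL (Fin 3) K) ∈ upperUnitriangular (Fin 3) K ∧
        Valued.v (((g : GL (Fin 3) K) : Matrix (Fin 3) (Fin 3) K) 0 1) ≤ WithZero.exp (-μ 0) ∧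
          Valued.v (((g : GL (Fin 3) K) : Matrix (Fin 3) (Fin 3) K) 0 2) ≤ WithZero.exp (-(2 * μ 0)) := by
  have hϖ0 := uniformizer_ne_zero hd.vϖ
  have hμ1 : μ 1 = 0 := by have := hμ 1; rw [show Fin.rev (1 : Fin 3) = 1 from by decide] at this; omega
  have hμ2 : μ 2 = -μ 0 := by have := hμ 0; rwa [show Fin.rev (0 : Fin 3) = 2 from by decide] at this
  rw [Subgroup.mem_pointwise_smul_iff_inv_smul_mem, ← toConjAct_inv, toConjAct_smul, inv_inv, hd.mem_borelInt_iff_three]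
  have hcoe : (((⟨zpowDiagGL hϖ0 μ, zpowDiagGL_mem_unitaryGroupOfForm hd.σϖ _ hμ⟩ :
        unitaryGroupOfForm σ ((StdForm.antidiagonal 3).over K))⁻¹ * g *
      (⟨zpowDiagGL hϖ0 μ, zpowDiagGL_mem_unitaryGroupOfForm hd.σϖ _ hμ⟩ :
        unitaryGroupOfForm σ ((StdForm.antidiagonal 3).over K)) : unitaryGroupOfForm σ ((StdForm.antidiagonal 3).over K)) :
        GL (Fin 3) K) = (zpowDiagGL hϖ0 μ)⁻¹ * (g : GL (Fin 3) K) * zpowDiagGL hϖ0 μ := by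
    rw [Subgroup.coe_mul, Subgroup.coe_mul, Subgroup.coe_inv]
  rw [hcoe, coe_conj_mem_upperUnitriangular_iff, coe_zpowDiagGL_inv_mul_mul_zpowDiagGL_apply,
    coe_zpowDiagGL_inv_mul_mul_zpowDiagGL_apply, hμ1, hμ2, zero_sub, v_uniformizer_zpow_mul_le_one_iff hd.vϖ,
    v_uniformizer_zpow_mul_le_one_iff hd.vϖ, show -μ 0 - μ 0 = -(2 * μ 0) by ring]

/-- **Every pair `(α, β)` with `β + σβ + ασα = 0` is the coordinate pair of an element `u(α, β) ∈ N(K) ≤ U(3)`**: the matrix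
`(1 α β; 0 1 -σα; 0 0 1)` lies in `U(σ, J₀)`. [cite: Rogawski1990, §1.10 p. 14] -/
theorem exists_unitriangular_apply_eq_three (hd : UnramifiedLocalConjDatum σ ϖ) {α β : K} (hαβ : β + σ β + α * σ α = 0) :
    ∃ g : unitaryGroupOfForm σ ((StdForm.antidiagonal 3).over K),
      (g : GL (Fin 3) K) ∈ upperUnitriangular (Fin 3) K ∧ ((g : GL (Fin 3) K) : Matrix (Fin 3) (Fin 3) K) 0 1 = α ∧
        ((g : GL (Fin 3) K) : Matrix (Fin 3) (Fin 3) K) 0 2 = β := by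
  have hσσ := hd.σσ
  have hdet : (!![(1 : K), α, β; 0, 1, -σ α; 0, 0, 1] : Matrix (Fin 3) (Fin 3) K).det ≠ 0 := by
    rw [Matrix.det_fin_three]; simp
  have hmem : Matrix.GeneralLinearGroup.mkOfDetNeZero _ hdet ∈ unitaryGroupOfForm σ ((StdForm.antidiagonal 3).over K) := by
    rw [mem_unitaryGroupOfForm_antidiagonal_iff_sum]
    intro a b
    have r0 : Fin.rev (0 : Fin 3) = 2 := by decide
    have r1 : Fin.rev (1 : Fin 3) = 1 := by decide
    have r2 : Fin.rev (2 : Fin 3) = 0 := by decide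
    have hσβ : σ β = -β - α * σ α := by linear_combination hαβ
    fin_cases a <;> fin_cases b <;>
      simp [Matrix.GeneralLinearGroup.mkOfDetNeZero, Fin.sum_univ_three, r0, r1, r2, hσσ, hσβ]
  refine ⟨⟨_, hmem⟩, ?_, rfl, rfl⟩
  rw [mem_upperUnitriangular_iff]
  refine ⟨fun i j hij => ?_, fun i => ?_⟩
  · fin_cases i <;> fin_cases j
    · exact absurd hij (by decide)
    · exact absurd hij (by decide)
    · exact absurd hij (by decide)
    · rfl
    · exact absurd hij (by decide)
    · exact absurd hij (by decide)
    · rfl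
    · rfl
    · exact absurd hij (by decide)
  · fin_cases i <;> rfl

omit [Valued K ℤᵐ⁰] in
/-- The section `α ↦ u(α, -ασα·t)`: for `t + σt = 1` the pair `(α, -ασα t)` satisfies the relation `β + σβ + ασα = 0`
(Rogawski's `u(x) = u(x, x x̄/2)` for `t = ½`; a trace-one `t` exists at every unramified place, also dyadic).
[cite: Rogawski1990, §1.10 p. 14] [cite: Serre1979, Ch. V §2] -/
theorem neg_mul_map_mul_rel (hσσ : ∀ x, σ (σ x) = x) {t : K} (ht : t + σ t = 1) (α : K) :
    -(α * σ α * t) + σ (-(α * σ α * t)) + α * σ α = 0 := by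
  rw [map_neg, map_mul, map_mul, hσσ]
  linear_combination (-(α * σ α)) * ht

/-- **THE MODULUS OF THE BOREL OF `U(3)` AS AN INDEX**: for `μ` antisymmetric (`μ = (μ₀, 0, -μ₀)`,
`t_μ = diag(ϖ^{μ₀}, 1, ϖ^{-μ₀})`) and `σ ≠ id`, **`[K_P : K_P ∩ t_μK_Pt_μ⁻¹] = q^{(2μ₀)⁺}`** (`q = #𝓀[K] = q_E`): for `μ₀ ≥ 0`,
inside `K_P = N(𝒪)` the `α`-coordinate `ψ : K_P → K` is a homomorphism onto `𝒪`, giving `[K_P : ψ⁻¹{v ≤ exp(-μ₀)}] = q^{μ₀}`,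
and `ψ⁻¹{v ≤ exp(-μ₀)} = Z(𝒪) · t_μK_Pt_μ⁻¹` with `Z(𝒪) = ker ψ` the integral centre, on which `β` is a homomorphism onto
`L_0 = 𝒪 ∩ K⁰`, giving `[ψ⁻¹{…} : t_μK_Pt_μ⁻¹] = [Z(𝒪) : Z(𝒪) ∩ t_μK_Pt_μ⁻¹] = [L_0 : L_{-2μ₀}] = q^{μ₀}` (g46-#1); for `μ₀ ≤ 0`
the index is `1`.  This is `δ_B(t_μ)^{-1} = q_E^{μ₀} q_F^{2μ₀} = q^{2μ₀}` (`μ₀ ≥ 0`). [cite: CartierCorvallis1979, §I.3, §IV (4.2)]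
[cite: Laumon1995, (4.1.3)–(4.1.4)] [cite: Rogawski1990, §1.10 p. 14] [cite: Minguez2011, §4] -/
theorem relIndex_conjAct_borelInt_eq_pow_three (hd : UnramifiedLocalConjDatum σ ϖ) (hσ : ∃ x : K, σ x ≠ x) [Finite 𝓀[K]]
    {μ : Fin 3 → ℤ} (hμ : ∀ i, μ (Fin.rev i) = -μ i) :
    (toConjAct (⟨zpowDiagGL (uniformizer_ne_zero hd.vϖ) μ, zpowDiagGL_mem_unitaryGroupOfForm hd.σϖ _ hμ⟩ :
          unitaryGroupOfForm σ ((StdForm.antidiagonal 3).over K)) •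
        (hd.borelLatticeU ⊓ unitaryInt σ ((StdForm.antidiagonal 3).over K))).relIndex
        (hd.borelLatticeU ⊓ unitaryInt σ ((StdForm.antidiagonal 3).over K)) = Nat.card 𝓀[K] ^ (2 * μ 0).toNat := by
  set KP := hd.borelLatticeU ⊓ unitaryInt σ ((StdForm.antidiagonal 3).over K) with hKP
  set A := toConjAct (⟨zpowDiagGL (uniformizer_ne_zero hd.vϖ) μ, zpowDiagGL_mem_unitaryGroupOfForm hd.σϖ _ hμ⟩ :
      unitaryGroupOfForm σ ((StdForm.antidiagonal 3).over K)) • KP with hA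
  have hμeq := eq_linear_three_of_rev μ hμ
  rcases lt_or_ge (μ 0) 0 with hneg | hpos
  · -- `μ` antidominant: `K_P ≤ t_μK_Pt_μ⁻¹`, index `1`
    have hmono : Monotone μ := by rw [hμeq]; exact monotone_linear_three _ hneg.le
    rw [Int.toNat_of_nonpos (by omega), pow_zero]
    exact Subgroup.relIndex_eq_one.2 (hd.inf_le_conjAct_smul_of_monotone_unitary hmono hμ)
  -- `μ` dominant: `A = t_μK_Pt_μ⁻¹ ≤ K_P`
  have hanti : Antitone μ := by rw [hμeq]; exact antitone_linear_three _ hpos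
  have hAle : A ≤ KP := hd.conjAct_smul_inf_le_of_antitone_unitary hanti hμ
  obtain ⟨t₀, ht₀, ht₀σ⟩ := hd.trace
  have hσσ := hd.σσ
  -- unitriangularity of the elements of `K_P`
  have hKU : ∀ g : KP, ((g : unitaryGroupOfForm σ ((StdForm.antidiagonal 3).over K)) : GL (Fin 3) K) ∈ upperUnitriangular (Fin 3) K :=
    fun g => (hd.mem_borelInt_iff_three.1 g.2).1
  -- the coordinate `α : K_P → K`
  let ψ : KP →* Multiplicative K :=
    { toFun := fun g => Multiplicative.ofAdd ((((g : unitaryGroupOfForm σ ((StdForm.antidiagonal 3).over K)) : GL (Fin 3) K) :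
        Matrix (Fin 3) (Fin 3) K) 0 1)
      map_one' := by
        rw [OneMemClass.coe_one, OneMemClass.coe_one, Units.val_one, Matrix.one_apply_ne (by decide), ofAdd_zero]
      map_mul' := fun g h => by
        rw [← ofAdd_add, Subgroup.coe_mul, Subgroup.coe_mul, Units.val_mul, Matrix.mul_apply, Fin.sum_univ_three,
          apply_self_of_mem_upperUnitriangular (hKU g), apply_self_of_mem_upperUnitriangular (hKU h),
          blockTriangular_of_mem_upperUnitriangular (hKU h) (show ((1 : Fin 3) : Fin 3) < 2 by decide), one_mul, mul_one,
          mul_zero, add_zero, add_comm] }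
  have hψ : ∀ g : KP, Multiplicative.toAdd (ψ g) =
      (((g : unitaryGroupOfForm σ ((StdForm.antidiagonal 3).over K)) : GL (Fin 3) K) : Matrix (Fin 3) (Fin 3) K) 0 1 := fun _ => rfl
  -- `A' = A ∩ K_P` in `K_P`, and the intermediate subgroup `A'' = ψ⁻¹{v ≤ exp(-μ₀)}`
  set A' : Subgroup KP := A.subgroupOf KP with hA'
  set A'' : Subgroup KP := (AddSubgroup.toSubgroup ((Valued.v : Valuation K ℤᵐ⁰).leAddSubgroup (WithZero.exp (-μ 0)))).comap ψ
    with hA''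
  have hmemA' : ∀ g : KP, g ∈ A' ↔
      Valued.v ((((g : unitaryGroupOfForm σ ((StdForm.antidiagonal 3).over K)) : GL (Fin 3) K) : Matrix (Fin 3) (Fin 3) K) 0 1) ≤
          WithZero.exp (-μ 0) ∧
        Valued.v ((((g : unitaryGroupOfForm σ ((StdForm.antidiagonal 3).over K)) : GL (Fin 3) K) : Matrix (Fin 3) (Fin 3) K) 0 2) ≤
          WithZero.exp (-(2 * μ 0)) := by
    intro g
    rw [hA', Subgroup.mem_subgroupOf, hA, hd.mem_conjAct_borelInt_iff_three hμ]
    exact ⟨fun h => h.2, fun h => ⟨hKU g, h⟩⟩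
  have hmemA'' : ∀ g : KP, g ∈ A'' ↔
      Valued.v ((((g : unitaryGroupOfForm σ ((StdForm.antidiagonal 3).over K)) : GL (Fin 3) K) : Matrix (Fin 3) (Fin 3) K) 0 1) ≤
        WithZero.exp (-μ 0) := by
    intro g
    rw [hA'', Subgroup.mem_comap, Multiplicative.mem_toSubgroup, Valuation.mem_leAddSubgroup_iff, hψ]
  have hA'le : A' ≤ A'' := fun g hg => (hmemA'' g).2 ((hmemA' g).1 hg).1
  -- (i) `[K_P : A''] = [𝒪 : ϖ^{μ₀}𝒪] = q^{μ₀}`: `ψ` maps `K_P` onto `𝒪`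
  have hrange : ψ.range = AddSubgroup.toSubgroup ((Valued.v : Valuation K ℤᵐ⁰).leAddSubgroup (WithZero.exp (0 : ℤ))) := by
    ext x
    rw [MonoidHom.mem_range, Multiplicative.mem_toSubgroup, Valuation.mem_leAddSubgroup_iff, WithZero.exp_zero]
    constructor
    · rintro ⟨g, rfl⟩
      exact (hd.mem_borelInt_iff_three.1 g.2).2.1
    · intro hx
      obtain ⟨g, hgU, hgα, hgβ⟩ := hd.exists_unitriangular_apply_eq_three (neg_mul_map_mul_rel hσσ ht₀σ (Multiplicative.toAdd x))
      have hgKP : g ∈ KP := by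
        refine hd.mem_borelInt_iff_three.2 ⟨hgU, by rw [hgα]; exact hx, ?_⟩
        rw [hgβ, Valuation.map_neg, map_mul, map_mul, hd.vσ]
        exact mul_le_one' (mul_le_one' hx hx) ht₀
      exact ⟨⟨g, hgKP⟩, by rw [← ofAdd_toAdd (ψ _), hψ]; exact congrArg _ hgα⟩
  have h₁ : A''.index = Nat.card 𝓀[K] ^ (μ 0).toNat := by
    rw [hA'', Subgroup.index_comap, hrange, relIndex_toSubgroup_leAddSubgroup_exp hd.vϖ, zero_sub, neg_neg]
  -- (ii) `[A'' : A'] = [ker ψ : ker ψ ∩ A']`: `A'' = ker ψ · A'`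
  have hkerle : ψ.ker ≤ A'' := by
    intro g hg
    rw [hmemA'', ← hψ, MonoidHom.mem_ker.1 hg, toAdd_one, map_zero]
    exact zero_le
  have hsub : ((A'' : Subgroup KP) : Set KP) ⊆ (ψ.ker : Set KP) * (A' : Set KP) := by
    intro g hg
    have hα := (hmemA'' g).1 hg
    obtain ⟨g', hg'U, hg'α, hg'β⟩ := hd.exists_unitriangular_apply_eq_three (neg_mul_map_mul_rel hσσ ht₀σ
      ((((g : unitaryGroupOfForm σ ((StdForm.antidiagonal 3).over K)) : GL (Fin 3) K) : Matrix (Fin 3) (Fin 3) K) 0 1))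
    have hg'A : g' ∈ A := by
      refine (hd.mem_conjAct_borelInt_iff_three hμ).2 ⟨hg'U, by rw [hg'α]; exact hα, ?_⟩
      rw [hg'β, Valuation.map_neg, map_mul, map_mul, hd.vσ, show -(2 * μ 0) = -μ 0 + -μ 0 by ring, WithZero.exp_add, ← mul_one
        (WithZero.exp (-μ 0) * WithZero.exp (-μ 0))]
      exact mul_le_mul' (mul_le_mul' hα hα) ht₀
    have hg'KP : g' ∈ KP := hAle hg'A
    refine Set.mem_mul.2 ⟨g * (⟨g', hg'KP⟩ : KP)⁻¹, ?_, ⟨g', hg'KP⟩, Subgroup.mem_subgroupOf.2 hg'A, by rw [inv_mul_cancel_right]⟩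
    rw [SetLike.mem_coe, MonoidHom.mem_ker, map_mul, map_inv, mul_inv_eq_one]
    refine Multiplicative.toAdd.injective ?_
    rw [hψ, hψ]
    exact hg'α.symm
  have h₂ : A'.relIndex A'' = (A' ⊓ ψ.ker).relIndex ψ.ker := by
    rw [relIndex_eq_relIndex_of_coe_subset_mul hkerle hsub, Subgroup.inf_relIndex_right]
  -- (iii) on `ker ψ = Z(𝒪)` the coordinate `β` is a homomorphism onto `L_0`, and `ker ψ ∩ A' = β⁻¹(L_{-2μ₀})`
  have hker01 : ∀ g : ψ.ker,
      ((((g : KP) : unitaryGroupOfForm σ ((StdForm.antidiagonal 3).over K)) : GL (Fin 3) K) : Matrix (Fin 3) (Fin 3) K) 0 1 = 0 := by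
    intro g
    rw [← hψ, MonoidHom.mem_ker.1 g.2, toAdd_one]
  let φ : ψ.ker →* Multiplicative K :=
    { toFun := fun g => Multiplicative.ofAdd
        (((((g : KP) : unitaryGroupOfForm σ ((StdForm.antidiagonal 3).over K)) : GL (Fin 3) K) : Matrix (Fin 3) (Fin 3) K) 0 2)
      map_one' := by
        rw [OneMemClass.coe_one, OneMemClass.coe_one, OneMemClass.coe_one, Units.val_one, Matrix.one_apply_ne (by decide),
          ofAdd_zero]
      map_mul' := fun g h => by
        rw [← ofAdd_add, Subgroup.coe_mul, Subgroup.coe_mul, Subgroup.coe_mul, Units.val_mul, Matrix.mul_apply, Fin.sum_univ_three,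
          apply_self_of_mem_upperUnitriangular (hKU g), apply_self_of_mem_upperUnitriangular (hKU h), hker01 g, one_mul,
          zero_mul, add_zero, mul_one, add_comm] }
  have hφ : ∀ g : ψ.ker, Multiplicative.toAdd (φ g) =
      ((((g : KP) : unitaryGroupOfForm σ ((StdForm.antidiagonal 3).over K)) : GL (Fin 3) K) : Matrix (Fin 3) (Fin 3) K) 0 2 :=
    fun _ => rfl
  have hcomap : (A' ⊓ ψ.ker).subgroupOf ψ.ker =
      (AddSubgroup.toSubgroup ((Valued.v : Valuation K ℤᵐ⁰).leAddSubgroup (WithZero.exp (-(2 * μ 0))))).comap φ := by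
    ext g
    rw [Subgroup.mem_subgroupOf, Subgroup.mem_inf, hmemA', hker01 g, map_zero, Subgroup.mem_comap, Multiplicative.mem_toSubgroup,
      Valuation.mem_leAddSubgroup_iff, hφ]
    exact ⟨fun h => h.1.2, fun h => ⟨⟨zero_le, h⟩, g.2⟩⟩
  have hrangeφ : φ.range = AddSubgroup.toSubgroup
      ((Valued.v : Valuation K ℤᵐ⁰).leAddSubgroup (WithZero.exp (0 : ℤ)) ⊓ (AddMonoidHom.id K + σ.toAddMonoidHom).ker) := by
    ext x
    rw [MonoidHom.mem_range, Multiplicative.mem_toSubgroup, AddSubgroup.mem_inf, Valuation.mem_leAddSubgroup_iff,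
      WithZero.exp_zero, mem_ker_id_add_iff]
    constructor
    · rintro ⟨g, rfl⟩
      refine ⟨(hd.mem_borelInt_iff_three.1 (g : KP).2).2.2, ?_⟩
      have h := apply_add_map_apply_eq_three hσσ (hKU g)
      rwa [hker01 g, zero_mul, add_zero] at h
    · rintro ⟨hx, hxσ⟩
      obtain ⟨g, hgU, hgα, hgβ⟩ := hd.exists_unitriangular_apply_eq_three (α := 0) (β := Multiplicative.toAdd x)
        (by rw [map_zero, mul_zero, add_zero]; exact hxσ)
      have hgKP : g ∈ KP := hd.mem_borelInt_iff_three.2 ⟨hgU, by rw [hgα, map_zero]; exact zero_le, by rw [hgβ]; exact hx⟩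
      have hgker : (⟨g, hgKP⟩ : KP) ∈ ψ.ker := by
        rw [MonoidHom.mem_ker, ← ofAdd_toAdd (ψ _), hψ]
        exact congrArg Multiplicative.ofAdd hgα |>.trans ofAdd_zero
      exact ⟨⟨⟨g, hgKP⟩, hgker⟩, by rw [← ofAdd_toAdd (φ _), hφ]; exact congrArg _ hgβ⟩
  have h₃ : (A' ⊓ ψ.ker).relIndex ψ.ker = Nat.card 𝓀[K] ^ (μ 0).toNat := by
    rw [Subgroup.relIndex, hcomap, Subgroup.index_comap, hrangeφ, AddSubgroup.relIndex_toSubgroup, relIndex_inf_right_eq,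
      hd.relIndex_leAddSubgroup_inf_ker_add_exp hσ, zero_sub, neg_neg, show (2 * μ 0).toNat = 2 * (μ 0).toNat by omega, pow_mul,
      sq, hd.sqrt_card_residueField_mul_self hσ]
  -- assemble
  rw [Subgroup.relIndex, ← hA', ← Subgroup.relIndex_mul_index hA'le, h₂, h₃, h₁, ← pow_add]
  congr 1
  omega

/-- **The dual index for `U(3)`**: `[t_μK_Pt_μ⁻¹ : K_P ∩ t_μK_Pt_μ⁻¹] = q^{(-2μ₀)⁺}` (conjugate by `t_μ⁻¹ = t_{-μ}`).
[cite: CartierCorvallis1979, §I.3, §IV (4.2)] [cite: Laumon1995, (4.1.4)] -/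
theorem relIndex_borelInt_conjAct_eq_pow_three (hd : UnramifiedLocalConjDatum σ ϖ) (hσ : ∃ x : K, σ x ≠ x) [Finite 𝓀[K]]
    {μ : Fin 3 → ℤ} (hμ : ∀ i, μ (Fin.rev i) = -μ i) :
    (hd.borelLatticeU ⊓ unitaryInt σ ((StdForm.antidiagonal 3).over K)).relIndex
        (toConjAct (⟨zpowDiagGL (uniformizer_ne_zero hd.vϖ) μ, zpowDiagGL_mem_unitaryGroupOfForm hd.σϖ _ hμ⟩ :
            unitaryGroupOfForm σ ((StdForm.antidiagonal 3).over K)) •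
          (hd.borelLatticeU ⊓ unitaryInt σ ((StdForm.antidiagonal 3).over K))) = Nat.card 𝓀[K] ^ (-(2 * μ 0)).toNat := by
  have hneg : ∀ i, (-μ) (Fin.rev i) = -(-μ) i := fun i => by rw [Pi.neg_apply, Pi.neg_apply, hμ]
  have e : (⟨zpowDiagGL (uniformizer_ne_zero hd.vϖ) (-μ), zpowDiagGL_mem_unitaryGroupOfForm hd.σϖ _ hneg⟩ :
        unitaryGroupOfForm σ ((StdForm.antidiagonal 3).over K)) =
      (⟨zpowDiagGL (uniformizer_ne_zero hd.vϖ) μ, zpowDiagGL_mem_unitaryGroupOfForm hd.σϖ _ hμ⟩ :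
        unitaryGroupOfForm σ ((StdForm.antidiagonal 3).over K))⁻¹ :=
    Subtype.ext (zpowDiagGL_neg _ μ)
  have h := hd.relIndex_conjAct_borelInt_eq_pow_three hσ hneg
  rw [e, toConjAct_inv] at h
  have e' := Subgroup.relIndex_pointwise_smul
    (toConjAct (⟨zpowDiagGL (uniformizer_ne_zero hd.vϖ) μ, zpowDiagGL_mem_unitaryGroupOfForm hd.σϖ _ hμ⟩ :
      unitaryGroupOfForm σ ((StdForm.antidiagonal 3).over K)))⁻¹
    (hd.borelLatticeU ⊓ unitaryInt σ ((StdForm.antidiagonal 3).over K))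
    (toConjAct (⟨zpowDiagGL (uniformizer_ne_zero hd.vϖ) μ, zpowDiagGL_mem_unitaryGroupOfForm hd.σϖ _ hμ⟩ :
      unitaryGroupOfForm σ ((StdForm.antidiagonal 3).over K)) • (hd.borelLatticeU ⊓ unitaryInt σ ((StdForm.antidiagonal 3).over K)))
  rw [inv_smul_smul] at e'
  rw [← e', h, Pi.neg_apply, mul_neg]

/-! ## §4 The counting Satake isomorphisms of `U(2)`, `U(3)` with the modulus evaluated -/

section Classical

variable {R : Type*} [CommRing R]

/-- **`range 𝒮_1 = {f : f = 0 off Λ⁻, f_λ = q^{2λ₀} · f_{-λ} (λ dominant)}` for the COUNTING transform of `ℋ(U(3), K₀; R)`**,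
over every commutative ring `R` (`q = #𝓀[K] = q_E`; `σ ≠ id`): g44-#9 with the index evaluated.
[cite: CartierCorvallis1979, §IV Thm. 4.1] [cite: Minguez2011, §4] [cite: Rogawski1990, §4.5 p. 50] -/
theorem range_satakeTransform_one_unitary_three_eq_pow
    [IsHeckeTriple (⊤ : Submonoid (unitaryGroupOfForm σ ((StdForm.antidiagonal 3).over K))) (unitaryInt σ ((StdForm.antidiagonal 3).over K))
      (unitaryInt σ ((StdForm.antidiagonal 3).over K))]
    (hd : UnramifiedLocalConjDatum σ ϖ) (hσ : ∃ x : K, σ x ≠ x) [Finite 𝓀[K]] :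
    Set.range ((hd.isIwasawaExponent (N := 3)).satakeTransform (1 : Multiplicative (Fin 3 → ℤ) →* R)) =
      {f | (∀ μ : Fin 3 → ℤ, (¬ ∀ i, μ (Fin.rev i) = -μ i) → f.coeff μ = 0) ∧
        ∀ μ : Fin 3 → ℤ, (∀ i, μ (Fin.rev i) = -μ i) → Antitone μ →
          f.coeff μ = f.coeff (-μ) * ((Nat.card 𝓀[K] ^ (2 * μ 0).toNat : ℕ) : R)} := by
  rw [hd.range_satakeTransform_one_unitary_three]
  ext f
  simp only [Set.mem_setOf_eq]
  refine and_congr_right fun _ => forall_congr' fun μ => ⟨fun h hμ hμa => ?_, fun h hμ hμa => ?_⟩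
  · rw [h hμ hμa, hd.relIndex_conjAct_borelInt_eq_pow_three hσ hμ]
  · rw [h hμ hμa, hd.relIndex_conjAct_borelInt_eq_pow_three hσ hμ]

/-- **`range 𝒮_1 = {f : f = 0 off Λ⁻, f_λ = q^{λ₀} · f_{-λ} (λ dominant)}` for the COUNTING transform of `ℋ(U(2), K₀; R)`**,
over every commutative ring `R` (`q = #𝓀[K] = q_E = q_F²`; `σ ≠ id`).
[cite: CartierCorvallis1979, §IV Thm. 4.1] [cite: Minguez2011, §4] [cite: Rogawski1990, §4.5 p. 50] -/
theorem range_satakeTransform_one_unitary_two_eq_pow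
    [IsHeckeTriple (⊤ : Submonoid (unitaryGroupOfForm σ ((StdForm.antidiagonal 2).over K))) (unitaryInt σ ((StdForm.antidiagonal 2).over K))
      (unitaryInt σ ((StdForm.antidiagonal 2).over K))]
    (hd : UnramifiedLocalConjDatum σ ϖ) (hσ : ∃ x : K, σ x ≠ x) [Finite 𝓀[K]] :
    Set.range ((hd.isIwasawaExponent (N := 2)).satakeTransform (1 : Multiplicative (Fin 2 → ℤ) →* R)) =
      {f | (∀ μ : Fin 2 → ℤ, (¬ ∀ i, μ (Fin.rev i) = -μ i) → f.coeff μ = 0) ∧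
        ∀ μ : Fin 2 → ℤ, (∀ i, μ (Fin.rev i) = -μ i) → Antitone μ →
          f.coeff μ = f.coeff (-μ) * ((Nat.card 𝓀[K] ^ (μ 0).toNat : ℕ) : R)} := by
  rw [hd.range_satakeTransform_one_unitary_two]
  ext f
  simp only [Set.mem_setOf_eq]
  refine and_congr_right fun _ => forall_congr' fun μ => ⟨fun h hμ hμa => ?_, fun h hμ hμa => ?_⟩
  · rw [h hμ hμa, hd.relIndex_conjAct_borelInt_eq_pow_two hσ hμ]
  · rw [h hμ hμa, hd.relIndex_conjAct_borelInt_eq_pow_two hσ hμ]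

end Classical

end UnramifiedLocalConjDatum

end Literature.NumberTheory.Automorphic.HermitianLattice

end
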